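import Literature.NumberTheory.Automorphic.AdelicUnitaryGroupDatum
import HarnessLib

/-!
# Bridge: Mok's quasi-split datum `quasiSplit L⁺ L c N` IS the CM datum `cmDatum L N Φ_N` of the
# anti-diagonal form (dictionary between the T1-qs letters and the T1 line's kit)
(Mok, *Endoscopic classification of representations of quasi-split unitary groups* (2015), §1;
Rogawski, *Automorphic Representations of Unitary Groups in Three Variables* (1990), §1.9)

Topic `NumberTheory/Automorphic`; namespace `Literature.NumberTheory.Automorphic`. THEOREMS ONLY (no
definition, no named fact, no instance, no notation).

The T1-qs letters (`UnitaryGroupBorelPair`, `…BorelTruncation`, `…ArthurTruncatedKernel`,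
`…ArthurTruncatedTrace`, `…BorelConstantTermInvariance`, …) are typed over the generic quasi-split
datum `UnitaryGroup.quasiSplit F E c N = adelicGroupData F E c N ((StdForm.antidiagonal N).over E)` of
a CM-like pair `(F, E, c)`; the ENGINE-T1 line (`Cruxes/H413/Lines/F0_T1InnerFormTraceIdentity`) types
the quasi-split side over `UnitaryGroup.cmDatum L N (splitForm L N)` with
`splitForm L N = Matrix.of fun i j => if i.val + j.val + 1 = N then 1 else 0`. This file records:

* `StdForm.over_antidiagonal_apply` — the entries of Mok's anti-diagonal form over any ring:
  `(StdForm.antidiagonal N).over R i j = if i.val + j.val + 1 = N then 1 else 0`, i.e. it IS the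
  line's `splitForm` matrix (entrywise, for every `N`);
* `UnitaryGroup.quasiSplit_eq_cmDatum` — at the CM pair `(L⁺, L, complexConj)`,
  **`quasiSplit L⁺ L c N = cmDatum L N ((StdForm.antidiagonal N).over L)` DEFINITIONALLY** (`rfl`,
  via ★ `adelicGroupData_eq_cmDatum`), so every T1-qs letter applies verbatim to the kit's
  `G = U(Φ_N)` once `splitForm L N` is spelled `(StdForm.antidiagonal N).over L`;
* the form is hermitian-symmetric and involutive over every ring (★ `StdForm.transpose_over`,
  `over_map`, `over_mul_over`, restated at the CM conjugation for the line's `IsHermitianCM` shape: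
  `cmConj_antidiagonal_transpose`).

## References

* C. P. Mok, *Endoscopic classification of representations of quasi-split unitary groups*, Mem. AMS
  235 (2015), §1 Notation p. 5 (`J_N`, `U_{E/F}(N)`) [Mok2014].
* J. D. Rogawski, *Automorphic Representations of Unitary Groups in Three Variables* (1990), §1.9
  (`Φ`, the quasi-split `U(3)`) [Rogawski1990].
-/

noncomputable section

open NumberField

namespace Literature.NumberTheory.Automorphic

/-- **Entries of Mok's anti-diagonal form**: `(J_N)_{ij} = 1` if `i + j + 1 = N` (0-based) and `0`
otherwise, over any ring — the line's `splitForm` formula (Mok (2015), §1: `J_N = antidiag(1,…,1)`;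
Rogawski (1990), §1.9: `Φ`). [cite: Mok2014, §1 Notation p. 5] -/
theorem StdForm.over_antidiagonal_apply {N : ℕ} (R : Type*) [Ring R] (i j : Fin N) :
    (StdForm.antidiagonal N).over R i j = if i.val + j.val + 1 = N then 1 else 0 := by
  simp only [StdForm.over, StdForm.antidiagonal, Matrix.map_apply, Matrix.of_apply]
  have h : (j = i.rev) ↔ i.val + j.val + 1 = N := by
    constructor
    · rintro rfl; rw [Fin.val_rev]; omega
    · intro h; ext; rw [Fin.val_rev]; omega
  by_cases hij : j = i.rev
  · rw [if_pos hij, if_pos (h.1 hij), map_one]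
  · rw [if_neg hij, if_neg (fun h' => hij (h.2 h')), map_zero]

/-- The anti-diagonal form as an explicit matrix: `(StdForm.antidiagonal N).over R` IS
`Matrix.of fun i j => if i.val + j.val + 1 = N then 1 else 0` (the ENGINE-T1 line's `splitForm`).
[cite: Mok2014, §1 Notation p. 5] -/
theorem StdForm.over_antidiagonal_eq {N : ℕ} (R : Type*) [Ring R] :
    (StdForm.antidiagonal N).over R = Matrix.of fun i j : Fin N => if i.val + j.val + 1 = N then (1 : R) else 0 := by
  ext i j
  rw [StdForm.over_antidiagonal_apply, Matrix.of_apply]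

namespace UnitaryGroup

variable (L : Type) [Field L] [NumberField L] [IsCMField L] (N : ℕ)

/-- **Mok's quasi-split datum at a CM field is the CM datum of the anti-diagonal form**,
definitionally: `quasiSplit L⁺ L c N = cmDatum L N ((StdForm.antidiagonal N).over L)` for
`c = IsCMField.complexConj L` (★ `adelicGroupData_eq_cmDatum`). Every letter typed over `quasiSplit`
(Borel pair, truncation `Λ^T`, kernels `K`, `K_B`, `k^T`, `J^T(f)`, …) is thereby a statement about the
T1 line's `G = U(Φ_N)`. [cite: Mok2014, §1 Notation p. 5] -/
theorem quasiSplit_eq_cmDatum :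
    quasiSplit (↥(maximalRealSubfield L)) L (IsCMField.complexConj L) N =
      cmDatum L N ((StdForm.antidiagonal N).over L) := rfl

/-- The same with the line's explicit matrix: `quasiSplit L⁺ L c N = cmDatum L N (Matrix.of …)`.
[cite: Mok2014, §1 Notation p. 5] -/
theorem quasiSplit_eq_cmDatum_of :
    quasiSplit (↥(maximalRealSubfield L)) L (IsCMField.complexConj L) N =
      cmDatum L N (Matrix.of fun i j : Fin N => if i.val + j.val + 1 = N then (1 : L) else 0) := by
  rw [← StdForm.over_antidiagonal_eq]; rfl

/-- **`Φ_N` is hermitian for the CM conjugation**: `(Φ_N.map c)ᵀ = Φ_N` (entries `0, 1` are fixed by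
`c`; ★ `StdForm.over_map`, `StdForm.transpose_over`) — the line's `IsHermitianCM` shape for the split
form. [cite: Rogawski1990, §1.9] -/
theorem cmConj_antidiagonal_transpose :
    (((StdForm.antidiagonal N).over L).map (cmConjRingHom L)).transpose =
      (StdForm.antidiagonal N).over L := by
  rw [StdForm.over_map, StdForm.transpose_over]

omit [NumberField L] [IsCMField L] in
/-- `Φ_N` is involutive, hence invertible: `Φ_N * Φ_N = 1`, `det Φ_N` is a unit.
[cite: Rogawski1990, §1.9] -/
theorem isUnit_det_antidiagonal_over : IsUnit ((StdForm.antidiagonal N).over L).det :=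
  (Matrix.isUnit_iff_isUnit_det _).1 ((StdForm.antidiagonal N).isUnit_over L)

end UnitaryGroup

end Literature.NumberTheory.Automorphic
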